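import Summits.CriticalPhenomena.Ising3D.Control2DL13BoxOTable
import Mathlib.Tactic.NormNum
import HarnessLib

/-!
# RB-2 certificate `j111517+j114355_functional_deriv2d_L13_E040_sig1o8_box0.94-0.95.json` (Λ = 13, E₀ = 40): Δ_ε ∉ [47/50, 19/20] at Δ_σ = 1/8 under A2D′ — (R), the large-`S` half, in the kernel
(cell `pub-ising3x`, seat controls-1 gen 17; KERNEL PATH for the 2D γ-certificates, Λ = 13 — CONTROL-ONLY)

HONEST FRAMING: lottery ticket; floor = tightest certified 3D Ising CFT bounds; no exact-solution
claim without a proof. CONTROL-ONLY (`d = 2`, `Δ_σ = 1/8`, the 2D Ising control; axiom set `A2D′`).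

(R) `region_boxO` for the table `wtboxO` (`Control2DL13BoxOTable`): the compactified region polynomial `QhatboxO`
(`S₁ = 80`, `d = 13`) is non-negative on `τ ∈ [0,1]`, `v ∈ [0,1]` by the tensor-Bernstein SHAPE tree `cregboxO`
(3 leaves; every Bernstein coefficient computed and decided in the kernel, `Control2DPolyCertAuto2`, in 1 chunks of
≤ 12 leaves re-assembled along the splits), and `S ≤ S₁` by the per-`J` shapes `cregJboxO` of the Table file;
`region_of_kernelCertAuto` turns the two kernel facts into hypothesis `hR` verbatim. No facts, standard axioms only.
-/

namespace Summit.CriticalPhenomena.Ising3D.Control2D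

open Literature.MathematicalPhysics.QuantumFieldTheory.ConformalBootstrap3D

set_option maxHeartbeats 0 in
set_option maxRecDepth 200000 in
/-- Chunk 0 of the large-`S` tree (box `q₁=1, a₁=0; q₂=1, a₂=0`; 3 leaves), decided in the kernel. [folklore] -/
theorem cregboxO_n0 :
    checkAuto₂ QhatboxO 14 1 0 1 1 0 1
    (Shape₂.splitO (Shape₂.leaf) (Shape₂.splitI (Shape₂.leaf) (Shape₂.leaf))) = true := by
  decide +kernel

/-- Tensor-Bernstein tree SHAPE for the compactified region polynomial on `[0,1] × [0,1]` (`S₁ = 80`; 3 leaves). [folklore] -/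
def cregboxO : Shape₂ :=
  Shape₂.splitO (Shape₂.leaf) (Shape₂.splitI (Shape₂.leaf) (Shape₂.leaf))

/-- **Kernel check of the large-`S` certificate** (assembled from the 1 chunks). [folklore] -/
theorem cregboxO_ok : checkAuto₂ QhatboxO 14 1 0 1 1 0 1 cregboxO = true :=
  cregboxO_n0

/-- **(R) for the table** (hypothesis `hR` of the explicit certificate theorems, `E₀ = 40`, `s = 1/8`): every
inequality re-decided in the kernel. [folklore] -/
theorem region_boxO (b : ℝ) (J : ℕ) (hb : 0 ≤ b) (hE : (40 : ℝ) ≤ 2 * b + J) :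
    0 ≤ ∑ p ∈ slL13.toFinset, (wtboxO p : ℝ) * ((1 - (-1 : ℝ) ^ (p.1 + p.2)) * 2 ^ (p.1 + p.2) *
      (qFactor₁ (1 / 8) (b + J) p.1 * qFactor₁ (1 / 8) b p.2 +
        qFactor₁ (1 / 8) b p.1 * qFactor₁ (1 / 8) (b + J) p.2)) :=
  region_of_kernelCertAuto wtboxO slL13_nodup slL13_deg 13 14 (by norm_num) (by norm_num) PregboxO_eq
    (by decide +kernel) QhatboxO_eq cregboxO cregboxO_ok cregJboxO (by decide) cregJboxO_ok b J hb
    (by exact_mod_cast hE)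

end Summit.CriticalPhenomena.Ising3D.Control2D
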